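import Summits.CriticalPhenomena.PercolationContinuityZ3.Theorems.PercNearOneGluingNoHeavyLowerTailE3FourPointSplitSunflower
import Summits.CriticalPhenomena.PercolationContinuityZ3.Theorems.PercNearOneGluingNoHeavyLowerTailE3FourPointClassesLeFive
import Summits.CriticalPhenomena.PercolationContinuityZ3.Theorems.PercNearOneGluingNoHeavyLowerTailE3GroupSepOfSahi
import Summits.CriticalPhenomena.PercolationContinuityZ3.Theorems.PercNearOneGluingNoHeavyLowerTailThreePointLBSwitching
import Literature.Probability.Percolation.KozmaNitzanPreFKG
import HarnessLib

/-!
# `NoHeavyLowerTail` (crux stmt-CriticalPhenomena-4575): the seven four-point E3GRP classes beyond `n ≤ 5` — classes `F` and `(ii)`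
# hold on EVERY finite weighted graph; class `γ` holds wherever four-point `AG⁺` does, and `γ ≥ −e₃` always

Support file (certificate seat `prim-cert-2` gen 9; `--supports stmt-CriticalPhenomena-4575`).  No definitions, no named facts, no
sorries, no `native_decide`.

`…E3FourPointClassesLeFive` (`fourPointClass_le_five`) certifies the seven classes `(iii), (ii), (b), F, α, β, γ` (`row4 0 … 6`) on every
weighted graph with at most five vertices by kernel-replayed three-copy certificates; a `K₆` replay is out of reach of the in-kernel
Kronecker check (memo prim-cert-2/FINDING-K6-THREECOPY-KERNEL-COST.md), and bounded-`n` theorems do not make a row "proved" anyway.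
This file records, in the same `Row4Holds` vocabulary and for EVERY `n` (no distinctness hypotheses needed):
* `rowHolds4_three_all` — class `F = E₃(D[a|b], D[a|c], D[b|c]) ≥ 0`: the four-switching theorem 3PT-LB = SHK3⁺
  (`ThreePointLB.sahiE3_pairSep_nonneg`);
* `rowHolds4_one_all` — class `(ii) = E₃(D[a|b], D[a|bcy], D[b|cy]) ≥ 0`: nested events and Harris (`sahiE3_nonneg_of_subset`);
* `rowHolds4_six_iff` — class `γ` (`row4 6`, = the five-terminal E3GRP row `r4`) is `0 ≤ E₃(U[ab|cy], U[ac|by], U[ay|bc])` with the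
  link events written by `openConn`; `rowSix_sahiE3_ge` — that `E₃` is `≥ −x₁x₂x₃` on every graph (`…E3FourPointSplitSunflower`);
  `rowHolds4_six_of_agPlus` — four-point `AG⁺` (`e₂(x) + e₃(x) ≤ R·Q` on the perfect-matching cells) implies class `γ`.
* `connEvent_sep_one_one/_one_two/_one_three`, `connEvent_lnk_two_two` — the dictionary `sep/lnk` ↔ `openConn` (with
  `e3Ineq_iff_sahiE3_nonneg` of `…E3GroupSepOfSahi`);  `rowHolds4_of_kahnConjecture` — Kahn's Conjecture 5 ⇒ all seven classes, every `n`
  (the honest conditional, companion of `rowHolds_of_kahnConjecture` for the nine five-terminal rows).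
Still open on general graphs: `(iii)` (= `E1` of the bern4 line), `(b)` (= SEP3 on groups), `α`, `β`, and `γ` beyond `AG⁺`.
-/

noncomputable section

namespace Summit.CriticalPhenomena.PercolationContinuityZ3.Theorems

open MeasureTheory Set
open Literature.Probability.Percolation Literature.Probability.LatticeModels

/-! ## The E3GRP four-point classes in the `Row4Holds` vocabulary of `…E3FourPointClassesLeFive`, for every `n` -/

namespace E3GroupSepCert

open FourPointSplit CovTransferCert

variable {n : ℕ}

/-- `D[a|b] = {a ↮ b}`. [this work] -/
theorem connEvent_sep_one_one (a b : Fin n) : connEvent (sep [a] [b]) = (openConn a b)ᶜ := by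
  rw [connEvent_sep]; ext ω; simp

/-- `D[a|bc] = {a ↮ b} ∩ {a ↮ c}`. [this work] -/
theorem connEvent_sep_one_two (a b c : Fin n) : connEvent (sep [a] [b, c]) = (openConn a b)ᶜ ∩ (openConn a c)ᶜ := by
  rw [connEvent_sep]; ext ω; simp

/-- `D[a|bcd] = {a ↮ b} ∩ {a ↮ c} ∩ {a ↮ d}`. [this work] -/
theorem connEvent_sep_one_three (a b c d : Fin n) :
    connEvent (sep [a] [b, c, d]) = (openConn a b)ᶜ ∩ (openConn a c)ᶜ ∩ (openConn a d)ᶜ := by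
  rw [connEvent_sep]; ext ω; simp [and_assoc]

/-- `U[ab|cd] = {a↔c} ∪ {a↔d} ∪ {b↔c} ∪ {b↔d}`. [this work] -/
theorem connEvent_lnk_two_two (a b c d : Fin n) :
    connEvent (lnk [a, b] [c, d]) = openConn a c ∪ openConn a d ∪ openConn b c ∪ openConn b d := by
  rw [connEvent_lnk]
  ext ω
  simp only [mem_setOf_eq, mem_union, List.mem_cons, List.not_mem_nil, or_false]
  constructor
  · rintro ⟨x, hx, z, hz, h⟩
    rcases hx with rfl | rfl <;> rcases hz with rfl | rfl
    exacts [Or.inl (Or.inl (Or.inl h)), Or.inl (Or.inl (Or.inr h)), Or.inl (Or.inr h), Or.inr h]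
  · rintro (((h | h) | h) | h)
    exacts [⟨a, Or.inl rfl, c, Or.inl rfl, h⟩, ⟨a, Or.inl rfl, d, Or.inr rfl, h⟩, ⟨b, Or.inr rfl, c, Or.inl rfl, h⟩,
      ⟨b, Or.inr rfl, d, Or.inr rfl, h⟩]

/-- **Class `F` (row `3`) on EVERY finite weighted graph**: `E₃(D[a|b], D[a|c], D[b|c]) ≥ 0` for all `n`, `w`, `a b c y` — the
four-switching theorem 3PT-LB = SHK3⁺ (`ThreePointLB.sahiE3_pairSep_nonneg`) in the `Row4Holds` vocabulary; no bound on `n`, no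
distinctness needed. [this work] -/
theorem rowHolds4_three_all (w : Sym2 (Fin n) → unitInterval) (a b c y : Fin n) : Row4Holds 3 w (a, b, c, y) := by
  have hr : row4 3 (a, b, c, y) = (sep [a] [b], sep [a] [c], sep [b] [c]) := rfl
  unfold Row4Holds
  rw [hr, e3Ineq_iff_sahiE3_nonneg, connEvent_sep_one_one, connEvent_sep_one_one, connEvent_sep_one_one]
  exact ThreePointLB.sahiE3_pairSep_nonneg w a b c

/-- **Class `(ii)` (row `1`) on EVERY finite weighted graph**: `E₃(D[a|b], D[a|bcy], D[b|cy]) ≥ 0` — nested events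
(`D[a|bcy] ⊆ D[a|b]`) and Harris for the decreasing pair `D[a|bcy], D[b|cy]`, by `sahiE3_nonneg_of_subset`. [this work] -/
theorem rowHolds4_one_all (w : Sym2 (Fin n) → unitInterval) (a b c y : Fin n) : Row4Holds 1 w (a, b, c, y) := by
  classical
  have hr : row4 1 (a, b, c, y) = (sep [a] [b], sep [a] [b, c, y], sep [b] [c, y]) := rfl
  unfold Row4Holds
  rw [hr, e3Ineq_iff_sahiE3_nonneg, connEvent_sep_one_one, connEvent_sep_one_three, connEvent_sep_one_two, sahiE3_comm₁₂]
  refine sahiE3_nonneg_of_subset (prodBernoulli w) (fun ω hω => hω.1.1) ?_ ?_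
  · exact (measureReal_mono (subset_univ _)).trans (by rw [probReal_univ])
  · exact prodBernoulli_harris_lower w
      (((isUpperSet_openConn a b).compl.inter (isUpperSet_openConn a c).compl).inter (isUpperSet_openConn a y).compl)
      ((isUpperSet_openConn b c).compl.inter (isUpperSet_openConn b y).compl) MeasurableSet.of_discrete
      MeasurableSet.of_discrete

/-- **Class `γ` (row `6`) is Sahi's `E₃` on the three split-link events**, written with `openConn`. [this work] -/
theorem rowHolds4_six_iff (w : Sym2 (Fin n) → unitInterval) (a b c y : Fin n) :
    Row4Holds 6 w (a, b, c, y) ↔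
      0 ≤ sahiE3 (prodBernoulli w) (openConn a c ∪ openConn a y ∪ openConn b c ∪ openConn b y)
        (openConn a b ∪ openConn a y ∪ openConn b c ∪ openConn c y)
        (openConn a b ∪ openConn a c ∪ openConn b y ∪ openConn c y) := by
  have hr : row4 6 (a, b, c, y) = (lnk [a, b] [c, y], lnk [a, c] [b, y], lnk [a, y] [b, c]) := rfl
  unfold Row4Holds
  rw [hr, e3Ineq_iff_sahiE3_nonneg, connEvent_lnk_two_two, connEvent_lnk_two_two, connEvent_lnk_two_two, KNPreFKG.openConn_symm c b,
    KNPreFKG.openConn_symm y b, KNPreFKG.openConn_symm y c]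

/-- **Class `γ ≥ −e₃(x)` for every `n`** (Gladkov), in the `Row4Holds`-adjacent form: the `E₃` of row `6` is at least minus the
product of the three perfect-matching petal masses. [this work] -/
theorem rowSix_sahiE3_ge (w : Sym2 (Fin n) → unitInterval) (a b c y : Fin n) :
    -((prodBernoulli w).real
              ((openConn a b ∪ openConn c y) \
                (openConn a b ∩ openConn a c ∪ openConn a b ∩ openConn a y ∪ openConn a c ∩ openConn a y ∪
                  openConn b c ∩ openConn b y)) *
            (prodBernoulli w).real
              ((openConn a c ∪ openConn b y) \
                (openConn a b ∩ openConn a c ∪ openConn a b ∩ openConn a y ∪ openConn a c ∩ openConn a y ∪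
                  openConn b c ∩ openConn b y)) *
          (prodBernoulli w).real
            ((openConn a y ∪ openConn b c) \
              (openConn a b ∩ openConn a c ∪ openConn a b ∩ openConn a y ∪ openConn a c ∩ openConn a y ∪
                openConn b c ∩ openConn b y))) ≤
      sahiE3 (prodBernoulli w) (connEvent (row4 6 (a, b, c, y)).1) (connEvent (row4 6 (a, b, c, y)).2.1)
        (connEvent (row4 6 (a, b, c, y)).2.2) := by
  have hr : row4 6 (a, b, c, y) = (lnk [a, b] [c, y], lnk [a, c] [b, y], lnk [a, y] [b, c]) := rfl
  rw [hr]
  simp only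
  rw [connEvent_lnk_two_two, connEvent_lnk_two_two, connEvent_lnk_two_two, KNPreFKG.openConn_symm c b, KNPreFKG.openConn_symm y b,
    KNPreFKG.openConn_symm y c]
  exact prodBernoulli_sahiE3_fourPointSplit_ge w a b c y

/-- **Class `γ` for every `n` from four-point `AG⁺`**: if `x₁x₂ + x₁x₃ + x₂x₃ + x₁x₂x₃ ≤ R·Q` for the perfect-matching cells of
`(a, b, c, y)` under `prodBernoulli w`, then `Row4Holds 6 w (a, b, c, y)`. [this work] -/
theorem rowHolds4_six_of_agPlus (w : Sym2 (Fin n) → unitInterval) (a b c y : Fin n)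
    (hG4 : (prodBernoulli w).real
              ((openConn a b ∪ openConn c y) \
                (openConn a b ∩ openConn a c ∪ openConn a b ∩ openConn a y ∪ openConn a c ∩ openConn a y ∪
                  openConn b c ∩ openConn b y)) *
            (prodBernoulli w).real
              ((openConn a c ∪ openConn b y) \
                (openConn a b ∩ openConn a c ∪ openConn a b ∩ openConn a y ∪ openConn a c ∩ openConn a y ∪
                  openConn b c ∩ openConn b y)) +
          (prodBernoulli w).real
              ((openConn a b ∪ openConn c y) \
                (openConn a b ∩ openConn a c ∪ openConn a b ∩ openConn a y ∪ openConn a c ∩ openConn a y ∪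
                  openConn b c ∩ openConn b y)) *
            (prodBernoulli w).real
              ((openConn a y ∪ openConn b c) \
                (openConn a b ∩ openConn a c ∪ openConn a b ∩ openConn a y ∪ openConn a c ∩ openConn a y ∪
                  openConn b c ∩ openConn b y)) +
          (prodBernoulli w).real
              ((openConn a c ∪ openConn b y) \
                (openConn a b ∩ openConn a c ∪ openConn a b ∩ openConn a y ∪ openConn a c ∩ openConn a y ∪
                  openConn b c ∩ openConn b y)) *
            (prodBernoulli w).real
              ((openConn a y ∪ openConn b c) \
                (openConn a b ∩ openConn a c ∪ openConn a b ∩ openConn a y ∪ openConn a c ∩ openConn a y ∪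
                  openConn b c ∩ openConn b y)) +
          (prodBernoulli w).real
              ((openConn a b ∪ openConn c y) \
                (openConn a b ∩ openConn a c ∪ openConn a b ∩ openConn a y ∪ openConn a c ∩ openConn a y ∪
                  openConn b c ∩ openConn b y)) *
            (prodBernoulli w).real
              ((openConn a c ∪ openConn b y) \
                (openConn a b ∩ openConn a c ∪ openConn a b ∩ openConn a y ∪ openConn a c ∩ openConn a y ∪
                  openConn b c ∩ openConn b y)) *
            (prodBernoulli w).real
              ((openConn a y ∪ openConn b c) \
                (openConn a b ∩ openConn a c ∪ openConn a b ∩ openConn a y ∪ openConn a c ∩ openConn a y ∪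
                  openConn b c ∩ openConn b y)) ≤
        (prodBernoulli w).real
            (openConn a b ∩ openConn a c ∪ openConn a b ∩ openConn a y ∪ openConn a c ∩ openConn a y ∪
              openConn b c ∩ openConn b y) *
          (prodBernoulli w).real
            ((openConn a b ∪ openConn c y) ∪ (openConn a c ∪ openConn b y) ∪ (openConn a y ∪ openConn b c))ᶜ) :
    Row4Holds 6 w (a, b, c, y) := by
  rw [rowHolds4_six_iff]
  exact (sahiE3_fourPoint_nonneg_of_agPlus w a b c y hG4).1

/-- **Kahn's Conjecture 5 ⇒ all seven four-point classes, on every finite weighted graph and every quadruple** (the honest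
conditional; companion of `rowHolds_of_kahnConjecture` for the nine five-terminal rows).  Unconditionally known: rows `1` and `3`
for every `n` (above), all rows for `n ≤ 5` (`fourPointClass_le_five`). [this work] -/
theorem rowHolds4_of_kahnConjecture (hK : KahnConjecture) (i : Fin 7) (w : Sym2 (Fin n) → unitInterval) (t : Quad n) :
    Row4Holds i w t := by
  obtain ⟨a, b, c, y⟩ := t
  fin_cases i
  · exact e3Ineq_sep_of_kahnConjecture hK w _ _ _ _ _ _
  · exact e3Ineq_sep_of_kahnConjecture hK w _ _ _ _ _ _
  · exact e3Ineq_sep_of_kahnConjecture hK w _ _ _ _ _ _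
  · exact e3Ineq_sep_of_kahnConjecture hK w _ _ _ _ _ _
  · exact e3Ineq_lnk_of_kahnConjecture hK w _ _ _ _ _ _
  · exact e3Ineq_lnk_of_kahnConjecture hK w _ _ _ _ _ _
  · exact e3Ineq_lnk_of_kahnConjecture hK w _ _ _ _ _ _

end E3GroupSepCert

end Summit.CriticalPhenomena.PercolationContinuityZ3.Theorems

end
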